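import Summits.BirchSwinnertonDyer.BirchSwinnertonDyer.Theorems.Rank1ResidualX1Converse
import Literature.NumberTheory.EllipticCurves.Rank1Residual.X1RankZeroCertificate

/-!
# Rank-≤1 BSD residual class X1 ∩ {r = 0}, `p ∣ #Ш_an`: Mazur's main conjecture at the pair from the
# finite certificate `Ш[p] ≠ 0` (prover B, gen 5)

HONEST FRAMING (cell `b2b-bsdres`, home `run/shared/lean/b2b/bsd-rank1-residual/`, unit
`b2b-bsdres-x1b`, prover B = the independent patchwork, no Keller–Yin input). The goal is to DELETE
the COMBINATION-SHAPED residual classes for ALL analytic-rank `≤ 1` curves over `ℚ` — "full BSD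
formula for every rank `≤ 1` curve in class C" assembled STRICTLY from published theorems — so that
the rank-`≤ 1` remainder becomes exactly the CONSTRUCTION-SHAPED classes, which are TYPED
(missing-input `Prop`s), NOT attempted; this is not "finishing BSD". Helper file of the crux
`stmt-BirchSwinnertonDyer-15418` in prover A's vocabulary (`MazurMainConjecture W p`,
`Rank1ResidualX1Defs`); theorems only.

On X1 ∩ {r = 0} the typed missing input `MazurMainConjecture W p` and the typed target `BSDp W p`
coincide (`Rank1ResidualX1Converse.mazurMainConjecture_iff_bsdp`, x1b gen 2). Gen 1/2 inhabited
them per pair where `p ∤ #Ш(E'/ℚ)_an` for an isogenous `E'` (Wuthrich Prop. 21 + Cassels). This file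
inhabits them at the remaining census shape — `ord_p #Ш(E'/ℚ)_an ≤ 2` with the FINITE CERTIFICATE
`p ∣ #Ш(E'/ℚ)` (one non-zero element of `Ш(E'/ℚ)` killed by `p`) — from PUBLISHED facts only:
Cassels–Tate squareness (bsd.S18), Wuthrich 2014 Prop. 21, Gross–Zagier–Kolyvagin, modularity,
Cassels' isogeny invariance, and for the main conjecture Wuthrich Thm. 16 + Greenberg Thm. 4.1
(Literature engine `Rank1Residual.X1.bsdp_of_casselsTate_of_dvd`,
`Rank1Residual.X1.mainConjecture_of_casselsTate_of_dvd`). Census (v5, N < 2·10⁴, complete): the two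
rank-`0` X1 pairs not reached by L1/L8 — `10406j1@3`, `15059d1@3`, `#Ш_an = 9` on every curve of the
class — carry this certificate by the prover's explicit `3`-isogeny descent on `10406j2`, `15059d2`
(`HOME/b2b-bsdres-x1b/gen5/desc3iso/`; lane to re-run). Per-curve, NOT a class theorem; no label
changes.

References: [Wuthrich2014] Thm. 16, Prop. 21; [GreenbergLNM1716] Thm. 4.1; [SilvermanAEC2009] X.4.14;
[MilneADT2006] I.7.3; [Miller2011LMS] Def. 1.1.
-/

noncomputable section

open scoped Classical MatrixGroups ModularForm

open CongruenceSubgroup WeierstrassCurve Literature.NumberTheory.EllipticCurves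
  Literature.NumberTheory.EllipticCurves.ModularForms Literature.NumberTheory.EllipticCurves.Rank1Residual
  Literature.NumberTheory.EllipticCurves.Rank1Residual.Typed
  Summit.BirchSwinnertonDyer.BirchSwinnertonDyer.Theorems.Rank1ResidualX1Defs
  Summit.BirchSwinnertonDyer.BirchSwinnertonDyer.Theorems.Rank1ResidualX1Converse

set_option linter.dupNamespace false
set_option autoImplicit false

namespace Summit.BirchSwinnertonDyer.BirchSwinnertonDyer.Theorems.Rank1ResidualX1RankZeroCertificate

/-- **Per-pair: `ord_p #Ш(E/ℚ)_an ≤ 2` and `p ∣ #Ш(E/ℚ)` ⟹ `MazurMainConjecture W p`** at an X1 pair with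
`ord_{s=1} L(E,s) = 0`: `BSD(E,p)` from Wuthrich Prop. 21 (`hW`) + Cassels–Tate squareness (`hCT`) +
Gross–Zagier–Kolyvagin (`hGZK`) + modularity (`hmod`), then the converse chain Wuthrich Thm. 16
(`hW16`) + Greenberg Thm. 4.1 (`hGr`) (`mazurMainConjecture_iff_bsdp`). Census: `10406j2@3`,
`15059d2@3` (certificate = a non-zero class of `Ш(E/ℚ)[φ̂]`, explicit `3`-isogeny descent).
[cite: Wuthrich2014, Thm. 16 (p. 393) and Prop. 21 (p. 400)] [cite: SilvermanAEC2009, Thm. X.4.14]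
[cite: GreenbergLNM1716, Thm. 4.1 and §5 (closing examples)] -/
theorem mazurMainConjecture_of_casselsTate_of_dvd (hCT : exists_casselsTate_pairing (K := ℚ))
    (hW : Wuthrich2014.sha_dvd_analyticSha) (hW16 : Wuthrich2014.charIdeal_dvd_padicLFunction)
    (hGr : greenberg_charValue_rankZero) (hmod' : nonempty_modularParametrizationData)
    (hmod : hasEntireLFunction_rat) (hGZK : rank_eq_analyticRank_of_analyticRank_le_one)
    (W : WeierstrassCurve ℚ) [W.IsElliptic] [W.IsGloballyMinimal] (p : ℕ) [Fact p.Prime]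
    (hX1 : ClassX1 W p) (hr0 : W.analyticRank = 0)
    {q : ℚ} (hq : shaAn W = (q : ℂ)) (hv : padicValRat p q ≤ 2) (hdvd : p ∣ W.shaOrder) :
    MazurMainConjecture W p :=
  (mazurMainConjecture_iff_bsdp hW16 hGr hmod' hGZK W p hX1 hr0).mpr
    (X1.bsdp_of_casselsTate_of_dvd hCT hW hGZK hmod W p (by omega) hX1 hr0 hq hv hdvd)

/-- **One-element form:** `ord_p #Ш(E/ℚ)_an ≤ 2` and a non-zero element of `Ш(E/ℚ)` killed by `p`
⟹ `MazurMainConjecture W p` (X1 pair, `r_an = 0`). [cite: Wuthrich2014, Thm. 16 and Prop. 21]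
[cite: SilvermanAEC2009, Thm. X.4.14] [cite: GreenbergLNM1716, Thm. 4.1] -/
theorem mazurMainConjecture_of_casselsTate_of_exists_torsion
    (hCT : exists_casselsTate_pairing (K := ℚ))
    (hW : Wuthrich2014.sha_dvd_analyticSha) (hW16 : Wuthrich2014.charIdeal_dvd_padicLFunction)
    (hGr : greenberg_charValue_rankZero) (hmod' : nonempty_modularParametrizationData)
    (hmod : hasEntireLFunction_rat) (hGZK : rank_eq_analyticRank_of_analyticRank_le_one)
    (W : WeierstrassCurve ℚ) [W.IsElliptic] [W.IsGloballyMinimal] (p : ℕ) [Fact p.Prime]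
    (hX1 : ClassX1 W p) (hr0 : W.analyticRank = 0)
    {q : ℚ} (hq : shaAn W = (q : ℂ)) (hv : padicValRat p q ≤ 2)
    (hx : ∃ x : W.sha, x ≠ 0 ∧ p • x = 0) : MazurMainConjecture W p :=
  mazurMainConjecture_of_casselsTate_of_dvd hCT hW hW16 hGr hmod' hmod hGZK W p hX1 hr0 hq hv
    (dvd_shaOrder_of_exists_torsion W p hx)

/-- **Per-pair, up to isogeny: the certificate on a `ℚ`-isogenous `E'` ⟹ `MazurMainConjecture W p`.**
`(E,p)` an X1 pair with `ord_{s=1} L(E,s) = 0`; `W' ∼ W` globally minimal with `ClassX1 W' p`,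
`ord_p #Ш(E'/ℚ)_an ≤ 2` and `p ∣ #Ш(E'/ℚ)`: `BSD(E,p)` by
`Rank1Residual.X1.bsdp_of_casselsTate_of_dvd_of_isIsogenous` (Cassels' invariance `hCassels`), then
the converse chain. Census: `10406j1@3` via `10406j2`, `15059d1@3` via `15059d2`.
[cite: GreenbergLNM1716, §5 (Conductor = 34: conjecture 1.13 is preserved by ℚ-isogeny)]
[cite: Wuthrich2014, Thm. 16 and Prop. 21] [cite: SilvermanAEC2009, Thm. X.4.14]
[cite: MilneADT2006, Thm. I.7.3] -/
theorem mazurMainConjecture_of_casselsTate_of_dvd_of_isIsogenous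
    (hCT : exists_casselsTate_pairing (K := ℚ))
    (hW : Wuthrich2014.sha_dvd_analyticSha) (hW16 : Wuthrich2014.charIdeal_dvd_padicLFunction)
    (hGr : greenberg_charValue_rankZero) (hmod' : nonempty_modularParametrizationData)
    (hmod : hasEntireLFunction_rat) (hGZK : rank_eq_analyticRank_of_analyticRank_le_one)
    (hCassels : bsdRHS_eq_of_isIsogenous)
    (W W' : WeierstrassCurve ℚ) [W.IsElliptic] [W'.IsElliptic] [W.IsGloballyMinimal]
    [W'.IsGloballyMinimal] (hiso : IsIsogenous W W') (p : ℕ) [Fact p.Prime]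
    (hX1 : ClassX1 W p) (hX1' : ClassX1 W' p) (hr0 : W.analyticRank = 0)
    {q' : ℚ} (hq' : shaAn W' = (q' : ℂ)) (hv' : padicValRat p q' ≤ 2) (hdvd' : p ∣ W'.shaOrder) :
    MazurMainConjecture W p :=
  (mazurMainConjecture_iff_bsdp hW16 hGr hmod' hGZK W p hX1 hr0).mpr
    (X1.bsdp_of_casselsTate_of_dvd_of_isIsogenous hCT hW hGZK hmod hCassels W W' hiso p (by omega)
      hX1' ((W.analyticRank_eq_zero_iff_holds (hmod W)).mp hr0) hq' hv' hdvd')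

/-- **Both curves at once:** at an X1 pair `(E,p)` with `r_an = 0` and a `ℚ`-isogenous X1 curve `E'`
carrying the certificate (`ord_p #Ш(E'/ℚ)_an ≤ 2`, `p ∣ #Ш(E'/ℚ)`), Mazur's main conjecture holds for
`(E,p)` AND for `(E',p)`, and `BSDp` holds for both. [cite: Wuthrich2014, Thm. 16 and Prop. 21]
[cite: SilvermanAEC2009, Thm. X.4.14] [cite: MilneADT2006, Thm. I.7.3] [cite: GreenbergLNM1716, Thm. 4.1] -/
theorem mazurMainConjecture_and_bsdp_pair_of_casselsTate_of_dvd
    (hCT : exists_casselsTate_pairing (K := ℚ))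
    (hW : Wuthrich2014.sha_dvd_analyticSha) (hW16 : Wuthrich2014.charIdeal_dvd_padicLFunction)
    (hGr : greenberg_charValue_rankZero) (hmod' : nonempty_modularParametrizationData)
    (hmod : hasEntireLFunction_rat) (hGZK : rank_eq_analyticRank_of_analyticRank_le_one)
    (hCassels : bsdRHS_eq_of_isIsogenous)
    (W W' : WeierstrassCurve ℚ) [W.IsElliptic] [W'.IsElliptic] [W.IsGloballyMinimal]
    [W'.IsGloballyMinimal] (hiso : IsIsogenous W W') (p : ℕ) [Fact p.Prime]
    (hX1 : ClassX1 W p) (hX1' : ClassX1 W' p) (hr0 : W.analyticRank = 0)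
    {q' : ℚ} (hq' : shaAn W' = (q' : ℂ)) (hv' : padicValRat p q' ≤ 2) (hdvd' : p ∣ W'.shaOrder) :
    (MazurMainConjecture W p ∧ BSDp W p) ∧ (MazurMainConjecture W' p ∧ BSDp W' p) := by
  have hL : W.entireLFunction 1 ≠ 0 := (W.analyticRank_eq_zero_iff_holds (hmod W)).mp hr0
  have hL' : W'.entireLFunction 1 ≠ 0 := by
    rwa [← entireLFunction_eq_of_isIsogenous' hiso]
  have hr0' : W'.analyticRank = 0 := analyticRank_eq_zero_of_entireLFunction_one_ne_zero W' hL'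
  have hB' : BSDp W' p :=
    X1.bsdp_of_casselsTate_of_dvd hCT hW hGZK hmod W' p (by omega) hX1' hr0' hq' hv' hdvd'
  have hB : BSDp W p :=
    X1.bsdp_of_casselsTate_of_dvd_of_isIsogenous hCT hW hGZK hmod hCassels W W' hiso p (by omega)
      hX1' hL hq' hv' hdvd'
  exact ⟨⟨(mazurMainConjecture_iff_bsdp hW16 hGr hmod' hGZK W p hX1 hr0).mpr hB, hB⟩,
    ⟨(mazurMainConjecture_iff_bsdp hW16 hGr hmod' hGZK W' p hX1' hr0').mpr hB', hB'⟩⟩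

end Summit.BirchSwinnertonDyer.BirchSwinnertonDyer.Theorems.Rank1ResidualX1RankZeroCertificate

end
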